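import Summits.AtomisticToContinuum.FouriersLaw.Theorems.LatticeLandauDampingAbelThermodynamicLimitAbelDeficitOfSignedTail
import Summits.AtomisticToContinuum.FouriersLaw.Theorems.LatticeLandauDampingAbelThermodynamicLimitEqualTimeBound
import Summits.AtomisticToContinuum.FouriersLaw.Theorems.LatticeLandauDampingAbelThermodynamicLimitAutocorrIntegrableOn
import Summits.AtomisticToContinuum.FouriersLaw.Theorems.EmbeddedDrudeMourreAbelThermodynamicLimitOfLowerBound
import Summits.AtomisticToContinuum.FouriersLaw.Theses.LatticeLandauDamping
import HarnessLib

/-!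
# The SIGNED-TAIL cut of (R) `UniformAbelianRegularity`: line `series-law-at-every-laplace-frequency` (SketchIdeator2),
rev 14 — crux `LatticeLandauDamping.AbelThermodynamicLimit` (stmt-AtomisticToContinuum-14013, `Iff.rfl`-identical to
`EmbeddedDrudeMourre.AbelThermodynamicLimit`, stmt-AtomisticToContinuum-12596); `--supports` glue file, closes nothing

The crux is reduced (p127832) to (R) = `StaticAbelianSqueeze.UniformAbelianRegularity` (stmt-AtomisticToContinuum-13416:
`|∫₀^∞ (1 − e^{−νt}) c_N(t) dt| ≤ εN` for `ν < ν₀(ε)`, `N ≥ N₀(ε, ν)`, `c_N(t) = ∫ J·(P_t J) dμ_{N,T}` the equilibrium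
autocorrelation of the total bond current of the OPEN `N`-chain) and CLB (stmt-AtomisticToContinuum-11749).  The birth skeleton of
(R) (`Cruxes/UniformAbelianRegularity/Lines/birth.lean`; importable form `…BirthCut.lean`) cuts (R) at an `N`-independent
horizon `τ` into an early bound and an `N`-uniform ABSOLUTE tail `∫_τ^∞ |c_N| ≤ εN` — a statement that bets on absolute
integrability of the bulk correlation (`C_T ∈ L¹`, STRATEGY-CENSUS N4/N7 of the twin crux).  This file removes that bet:

  `∫_{(τ,∞)} (1 − e^{−νt}) c(t) dt = (1 − e^{−ντ})·G(τ) + ∫_{(τ,∞)} ν e^{−νs} G(s) ds`,   `G(t) = ∫_{(t,∞)} c`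

(Fubini on the wedge `τ < s < t`; landed abstract lemma `stub_abelDeficitOfSignedTail`, p146330), so the late piece of the Abel
deficit is controlled by the SIGNED tails `sup_{t ≥ τ} |G(t)|`.  Hence (R) follows from the early bound (landed `stub_equalTimeBound`,
p144650), fixed-`N` integrability (landed `stub_autocorrIntegrableOn`, p144688) and the SIGNED UNIFORM TAIL

  (ST)  `∀ ε > 0 ∃ τ > 0 ∃ N₀ ∀ N ≥ N₀ ∀ t ≥ τ :  |∫_{(t,∞)} c_N(s) ds| ≤ ε·N`

— per unit length, the running Green–Kubo integrals `(1/N)∫₀^t c_N` stabilise uniformly in `N` beyond an `N`-independent time.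
(ST) is implied by the absolute tail (`uniformSignedTail_of_uniformAbsTail`), is sign-sensitive, and is stronger than (R) by
exactly a Tauberian condition (uniform stabilisation instead of Abel means; cf. the two-limit form of (R), p132484).

* `uniformSignedTail_of_uniformAbsTail` — absolute tail ⇒ (ST);
* `uniformAbelianRegularity_of_signedTail` — early bound → fixed-`N` integrability → signed-tail Abel-deficit lemma → (ST) → (R) BY NAME;
* `stub_uniformAbelianRegularityOfUniformSignedTail` (registered glue stub) — **(R) BY NAME from (ST) ALONE** (the other three are landed);
* `stub_cruxOfUniformSignedTailOfLowerBound` (registered glue stub) — the crux BY NAME from (ST) and CLB (through p127832; twin decl by rfl).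

What is NOT here: (ST) itself (`stub_uniformSignedTail`, lead-held residual, open-problem class: it contains the convergence of the
finite-size conductivity `T²D_N` — sharp `HasBoundedResponse` — and is false at the harmonic corner) and CLB (led in its own chain).
No named fact is used; nothing here closes an item.  References: Bonetto–Lebowitz–Rey-Bellet 2000 §7; Kundu–Dhar–Narayan 2009.
-/

noncomputable section

open MeasureTheory ProbabilityTheory Filter Topology Set Function
open scoped NNReal ENNReal

namespace Summit.AtomisticToContinuum.FouriersLaw.Theorems.AbelThermodynamicLimit.SeriesLawAtEveryLaplaceFrequency

open Literature.MathematicalPhysics.KineticTheory.HeatConduction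

/-! ## §1 Absolute tail ⇒ signed uniform tail -/

/-- **The absolute tail implies the signed uniform tail (ST)**: `|∫_{(t,∞)} c_N| ≤ ∫_{(t,∞)} |c_N| ≤ ∫_{(τ,∞)} |c_N| ≤ εN` for `t ≥ τ`,
using the landed fixed-`N` integrability `stub_autocorrIntegrableOn`. [folklore] -/
theorem uniformSignedTail_of_uniformAbsTail :
    (∀ ω₂ lam β γ : ℝ, 0 < ω₂ → 0 < lam → 0 < β → 0 < γ → ∀ T : ℝ, 0 < T → ∀ ε : ℝ, 0 < ε → ∃ τ : ℝ, 0 < τ ∧ ∃ N₀ : ℕ, ∀ N : ℕ, N₀ ≤ N → let J : Literature.MathematicalPhysics.KineticTheory.HeatConduction.PhaseSpace N → ℝ := fun z => ∑ i : Fin N, (Literature.MathematicalPhysics.KineticTheory.HeatConduction.pinnedChain ω₂ lam β γ).bondCurrent N i z; (∫ t in Set.Ioi τ, |∫ z, J z * (∫ y, J y ∂((Literature.MathematicalPhysics.KineticTheory.HeatConduction.pinnedChain ω₂ lam β γ).transitionKernel N T T t.toNNReal z)) ∂((Literature.MathematicalPhysics.KineticTheory.HeatConduction.pinnedChain ω₂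 lam β γ).gibbsMeasure N T)|) ≤ ε * N) →
    ∀ ω₂ lam β γ : ℝ, 0 < ω₂ → 0 < lam → 0 < β → 0 < γ → ∀ T : ℝ, 0 < T → ∀ ε : ℝ, 0 < ε → ∃ τ : ℝ, 0 < τ ∧ ∃ N₀ : ℕ, ∀ N : ℕ, N₀ ≤ N → ∀ t : ℝ, τ ≤ t → let J : Literature.MathematicalPhysics.KineticTheory.HeatConduction.PhaseSpace N → ℝ := fun z => ∑ i : Fin N, (Literature.MathematicalPhysics.KineticTheory.HeatConduction.pinnedChain ω₂ lam β γ).bondCurrent N i z; |∫ s in Set.Ioi t, ∫ z, J z * (∫ y, J y ∂((Literature.MathematicalPhysics.KineticTheory.HeatConduction.pinnedChain ω₂ lam β γ).transitionKernel N T T s.toNNReal z)) ∂((Literature.MathematicalPhysics.KineticTheory.HeatConduction.pinnedChain ω₂ lam β γ).gibbsMeasure N T)| ≤ ε * N := by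
  intro h ω₂ lam β γ hω hl hβ hγ T hT ε hε
  obtain ⟨τ, hτ, N₀, hN₀⟩ := h ω₂ lam β γ hω hl hβ hγ T hT ε hε
  refine ⟨τ, hτ, N₀, fun N hN t ht => ?_⟩
  intro J
  have hint : MeasureTheory.IntegrableOn (fun t : ℝ => ∫ z, J z * (∫ y, J y ∂((Literature.MathematicalPhysics.KineticTheory.HeatConduction.pinnedChain ω₂ lam β γ).transitionKernel N T T t.toNNReal z)) ∂((Literature.MathematicalPhysics.KineticTheory.HeatConduction.pinnedChain ω₂ lam β γ).gibbsMeasure N T)) (Set.Ioi 0) :=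
    stub_autocorrIntegrableOn ω₂ lam β γ hω hl hβ hγ T hT N
  have ht0 : 0 < t := lt_of_lt_of_le hτ ht
  have h1 : |∫ s in Set.Ioi t, ∫ z, J z * (∫ y, J y ∂((Literature.MathematicalPhysics.KineticTheory.HeatConduction.pinnedChain ω₂ lam β γ).transitionKernel N T T s.toNNReal z)) ∂((Literature.MathematicalPhysics.KineticTheory.HeatConduction.pinnedChain ω₂ lam β γ).gibbsMeasure N T)| ≤ ∫ s in Set.Ioi t, |∫ z, J z * (∫ y, J y ∂((Literature.MathematicalPhysics.KineticTheory.HeatConduction.pinnedChain ω₂ lam β γ).transitionKernel N T T s.toNNReal z)) ∂((Literature.MathematicalPhysics.KineticTheory.HeatConduction.pinnedChain ω₂ lam β γ).gibbsMeasure N T)| :=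
    MeasureTheory.abs_integral_le_integral_abs
  have h2 : (∫ s in Set.Ioi t, |∫ z, J z * (∫ y, J y ∂((Literature.MathematicalPhysics.KineticTheory.HeatConduction.pinnedChain ω₂ lam β γ).transitionKernel N T T s.toNNReal z)) ∂((Literature.MathematicalPhysics.KineticTheory.HeatConduction.pinnedChain ω₂ lam β γ).gibbsMeasure N T)|) ≤ ∫ s in Set.Ioi τ, |∫ z, J z * (∫ y, J y ∂((Literature.MathematicalPhysics.KineticTheory.HeatConduction.pinnedChain ω₂ lam β γ).transitionKernel N T T s.toNNReal z)) ∂((Literature.MathematicalPhysics.KineticTheory.HeatConduction.pinnedChain ω₂ lam β γ).gibbsMeasure N T)| :=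
    MeasureTheory.setIntegral_mono_set ((hint.mono_set (Set.Ioi_subset_Ioi hτ.le)).abs)
      (MeasureTheory.ae_of_all _ fun s => abs_nonneg _) (MeasureTheory.ae_of_all _ (Set.Ioi_subset_Ioi ht))
  exact h1.trans (h2.trans (hN₀ N hN))


/-! ## §2 The signed-tail composition: EARLY bound → fixed-`N` integrability → abstract lemma → (ST) → (R) by name -/

/-- **The signed-tail composition** (all four ingredients as hypotheses): the `stub_equalTimeBound`-statement, the
`stub_autocorrIntegrableOn`-statement, the `stub_abelDeficitOfSignedTail`-statement and (ST) imply
`StaticAbelianSqueeze.UniformAbelianRegularity` BY NAME.  Given `ε`: `τ, N₂` from (ST) at `ε/4`, `C, N₁` from the early bound,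
`C' = max C 1`, `ν₀ = ε/(2(C'τ²+1))`; for `0 < ν < ν₀`, `N ≥ max N₁ N₂`: `|∫₀^∞(1−e^{−νt})c_N| ≤ ντ²C'N + 2(εN/4) ≤ εN`. [folklore] -/
theorem uniformAbelianRegularity_of_signedTail :
    (∀ ω₂ lam β γ : ℝ, 0 < ω₂ → 0 < lam → 0 < β → 0 < γ → ∀ T : ℝ, 0 < T → ∃ C : ℝ, ∃ N₀ : ℕ, ∀ N : ℕ, N₀ ≤ N → ∀ t : ℝ, 0 < t → let J : Literature.MathematicalPhysics.KineticTheory.HeatConduction.PhaseSpace N → ℝ := fun z => ∑ i : Fin N, (Literature.MathematicalPhysics.KineticTheory.HeatConduction.pinnedChain ω₂ lam β γ).bondCurrent N i z; |∫ z, J z * (∫ y, J y ∂((Literature.MathematicalPhysics.KineticTheory.HeatConduction.pinnedChain ω₂ lam β γ).transitionKernel N T T t.toNNReal z)) ∂((Literature.MathematicalPhysics.KineticTheory.HeatConduction.pinnedChain ω₂ lam β γ).gibbsMeasure N T)| ≤ C * N) →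
    (∀ ω₂ lam β γ : ℝ, 0 < ω₂ → 0 < lam → 0 < β → 0 < γ → ∀ T : ℝ, 0 < T → ∀ N : ℕ, let J : Literature.MathematicalPhysics.KineticTheory.HeatConduction.PhaseSpace N → ℝ := fun z => ∑ i : Fin N, (Literature.MathematicalPhysics.KineticTheory.HeatConduction.pinnedChain ω₂ lam β γ).bondCurrent N i z; MeasureTheory.IntegrableOn (fun t : ℝ => ∫ z, J z * (∫ y, J y ∂((Literature.MathematicalPhysics.KineticTheory.HeatConduction.pinnedChain ω₂ lam β γ).transitionKernel N T T t.toNNReal z)) ∂((Literature.MathematicalPhysics.KineticTheory.HeatConduction.pinnedChain ω₂ lam β γ).gibbsMeasure N T)) (Set.Ioi 0)) →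
    (∀ (c : ℝ → ℝ) (ν τ C B : ℝ), 0 < ν → 0 < τ → 0 ≤ C → 0 ≤ B → MeasureTheory.IntegrableOn c (Set.Ioi 0) → (∀ t : ℝ, 0 < t → |c t| ≤ C) → (∀ t : ℝ, τ ≤ t → |∫ s in Set.Ioi t, c s| ≤ B) → |∫ t in Set.Ioi (0:ℝ), (1 - Real.exp (-(ν * t))) * c t| ≤ ν * τ ^ 2 * C + 2 * B) →
    (∀ ω₂ lam β γ : ℝ, 0 < ω₂ → 0 < lam → 0 < β → 0 < γ → ∀ T : ℝ, 0 < T → ∀ ε : ℝ, 0 < ε → ∃ τ : ℝ, 0 < τ ∧ ∃ N₀ : ℕ, ∀ N : ℕ, N₀ ≤ N → ∀ t : ℝ, τ ≤ t → let J : Literature.MathematicalPhysics.KineticTheory.HeatConduction.PhaseSpace N → ℝ := fun z => ∑ i : Fin N, (Literature.MathematicalPhysics.KineticTheory.HeatConduction.pinnedChain ω₂ lam β γ).bondCurrent N i z; |∫ s in Set.Ioi t, ∫ z, J z * (∫ y, J y ∂((Literature.MathematicalPhysics.KineticTheory.HeatConduction.pinnedChain ω₂ lam β γ).transitionKernel N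 T T s.toNNReal z)) ∂((Literature.MathematicalPhysics.KineticTheory.HeatConduction.pinnedChain ω₂ lam β γ).gibbsMeasure N T)| ≤ ε * N) →
    _root_.Summit.AtomisticToContinuum.FouriersLaw.Theses.StaticAbelianSqueeze.UniformAbelianRegularity := by
  intro h1 hI hAD h2 ω₂ lam β γ hω hl hβ hγ T hT ε hε
  obtain ⟨C, N₁, hC⟩ := h1 ω₂ lam β γ hω hl hβ hγ T hT
  obtain ⟨τ, hτ, N₂, hL⟩ := h2 ω₂ lam β γ hω hl hβ hγ T hT (ε / 4) (by positivity)
  have hC' : 0 < max C 1 := lt_of_lt_of_le one_pos (le_max_right _ _)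
  have hden : 0 < 2 * (max C 1 * τ ^ 2 + 1) := by positivity
  refine ⟨ε / (2 * (max C 1 * τ ^ 2 + 1)), div_pos hε hden, fun ν hν hνlt => ⟨max N₁ N₂, fun N hN => ?_⟩⟩
  have hN1 : N₁ ≤ N := le_trans (le_max_left _ _) hN
  have hN2 : N₂ ≤ N := le_trans (le_max_right _ _) hN
  have hN0 : (0:ℝ) ≤ N := Nat.cast_nonneg N
  intro J
  have hint : MeasureTheory.IntegrableOn (fun t : ℝ => ∫ z, J z * (∫ y, J y ∂((Literature.MathematicalPhysics.KineticTheory.HeatConduction.pinnedChain ω₂ lam β γ).transitionKernel N T T t.toNNReal z)) ∂((Literature.MathematicalPhysics.KineticTheory.HeatConduction.pinnedChain ω₂ lam β γ).gibbsMeasure N T)) (Set.Ioi 0) := hI ω₂ lam β γ hω hl hβ hγ T hT N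
  have hbound : ∀ t : ℝ, 0 < t → |∫ z, J z * (∫ y, J y ∂((Literature.MathematicalPhysics.KineticTheory.HeatConduction.pinnedChain ω₂ lam β γ).transitionKernel N T T t.toNNReal z)) ∂((Literature.MathematicalPhysics.KineticTheory.HeatConduction.pinnedChain ω₂ lam β γ).gibbsMeasure N T)| ≤ max C 1 * N := fun t ht =>
    le_trans (hC N hN1 t ht) (mul_le_mul_of_nonneg_right (le_max_left _ _) hN0)
  have htail : ∀ t : ℝ, τ ≤ t → |∫ s in Set.Ioi t, ∫ z, J z * (∫ y, J y ∂((Literature.MathematicalPhysics.KineticTheory.HeatConduction.pinnedChain ω₂ lam β γ).transitionKernel N T T s.toNNReal z)) ∂((Literature.MathematicalPhysics.KineticTheory.HeatConduction.pinnedChain ω₂ lam β γ).gibbsMeasure N T)| ≤ ε / 4 * N := fun t ht => hL N hN2 t ht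
  have key := hAD (fun t : ℝ => ∫ z, J z * (∫ y, J y ∂((Literature.MathematicalPhysics.KineticTheory.HeatConduction.pinnedChain ω₂ lam β γ).transitionKernel N T T t.toNNReal z)) ∂((Literature.MathematicalPhysics.KineticTheory.HeatConduction.pinnedChain ω₂ lam β γ).gibbsMeasure N T)) ν τ (max C 1 * N) (ε / 4 * N) hν hτ (mul_nonneg hC'.le hN0) (by positivity) hint hbound htail
  refine le_trans key ?_
  have hν2 : ν * (2 * (max C 1 * τ ^ 2 + 1)) < ε := (lt_div_iff₀ hden).1 hνlt
  have h4 : ν * τ ^ 2 * max C 1 ≤ ε / 2 := by nlinarith [hν.le]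
  have h5 : ν * τ ^ 2 * (max C 1 * (N : ℝ)) ≤ ε / 2 * N := by
    calc ν * τ ^ 2 * (max C 1 * (N : ℝ)) = (ν * τ ^ 2 * max C 1) * N := by ring
      _ ≤ ε / 2 * N := mul_le_mul_of_nonneg_right h4 hN0
  linarith


/-! ## §3 Plugging in the landed ingredients: (R) and the crux from the ONE signed residual -/

/-- **Registered glue stub `stub_uniformAbelianRegularityOfUniformSignedTail` — (R) BY NAME from (ST) ALONE.**  For
`P = pinnedChain ω₂ lam β γ` (all `> 0`), `T > 0`: IF `∀ ε > 0 ∃ τ > 0 ∃ N₀ ∀ N ≥ N₀ ∀ t ≥ τ, |∫_{(t,∞)} c_N| ≤ ε·N` THEN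
`StaticAbelianSqueeze.UniformAbelianRegularity` (item stmt-AtomisticToContinuum-13416) — by `uniformAbelianRegularity_of_signedTail` with the
landed `stub_equalTimeBound` (p144650), `stub_autocorrIntegrableOn` (p144688), `stub_abelDeficitOfSignedTail` (p146330).
[cite: BonettoLebowitzReyBellet2000, §7 eq. (35)] -/
theorem stub_uniformAbelianRegularityOfUniformSignedTail :
    (∀ ω₂ lam β γ : ℝ, 0 < ω₂ → 0 < lam → 0 < β → 0 < γ → ∀ T : ℝ, 0 < T → ∀ ε : ℝ, 0 < ε → ∃ τ : ℝ, 0 < τ ∧ ∃ N₀ : ℕ, ∀ N : ℕ, N₀ ≤ N → ∀ t : ℝ, τ ≤ t → let J : Literature.MathematicalPhysics.KineticTheory.HeatConduction.PhaseSpace N → ℝ := fun z => ∑ i : Fin N, (Literature.MathematicalPhysics.KineticTheory.HeatConduction.pinnedChain ω₂ lam β γ).bondCurrent N i z; |∫ s in Set.Ioi t, ∫ z, J z * (∫ y, J y ∂((Literature.MathematicalPhysics.KineticTheory.HeatConduction.pinnedChain ω₂ lam β γ).transitionKernel N T T s.toNNReal z)) ∂((Literature.MathematicalPhysics.KineticTheory.HeatConduction.pinnedChain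 ω₂ lam β γ).gibbsMeasure N T)| ≤ ε * N) → Summit.AtomisticToContinuum.FouriersLaw.Theses.StaticAbelianSqueeze.UniformAbelianRegularity :=
  uniformAbelianRegularity_of_signedTail stub_equalTimeBound stub_autocorrIntegrableOn stub_abelDeficitOfSignedTail

/-- **Registered glue stub `stub_cruxOfUniformSignedTailOfLowerBound` — the crux BY NAME from (ST) and CLB**: (R) from (ST), then the
twin's landed certificate `LoomisCompactHorizonWitness.stub_cruxOfRegularityOfLowerBound` (p127832: (R) → CLB → crux, hypothesis witness
unused); the two crux decls are definitionally equal. [cite: BonettoLebowitzReyBellet2000, §7 eq. (37)] [cite: KunduDharNarayan2009, eqs. (8)–(15)] -/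
theorem stub_cruxOfUniformSignedTailOfLowerBound :
    (∀ ω₂ lam β γ : ℝ, 0 < ω₂ → 0 < lam → 0 < β → 0 < γ → ∀ T : ℝ, 0 < T → ∀ ε : ℝ, 0 < ε → ∃ τ : ℝ, 0 < τ ∧ ∃ N₀ : ℕ, ∀ N : ℕ, N₀ ≤ N → ∀ t : ℝ, τ ≤ t → let J : Literature.MathematicalPhysics.KineticTheory.HeatConduction.PhaseSpace N → ℝ := fun z => ∑ i : Fin N, (Literature.MathematicalPhysics.KineticTheory.HeatConduction.pinnedChain ω₂ lam β γ).bondCurrent N i z; |∫ s in Set.Ioi t, ∫ z, J z * (∫ y, J y ∂((Literature.MathematicalPhysics.KineticTheory.HeatConduction.pinnedChain ω₂ lam β γ).transitionKernel N T T s.toNNReal z)) ∂((Literature.MathematicalPhysics.KineticTheory.HeatConduction.pinnedChain ω₂ lam β γ).gibbsMeasure N T)| ≤ ε * N) → Summit.AtomisticToContinuum.FouriersLaw.Theses.StaticAbelianSqueeze.ConductanceLowerBound → Summit.AtomisticToContinuum.FouriersLaw.Theses.LatticeLandauDamping.AbelThermodynamicLimit :=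
  fun h hCLB =>
    Summit.AtomisticToContinuum.FouriersLaw.Theorems.AbelThermodynamicLimit.LoomisCompactHorizonWitness.stub_cruxOfRegularityOfLowerBound
      (stub_uniformAbelianRegularityOfUniformSignedTail h) hCLB

/-- The same composition for the `Iff.rfl`-identical twin crux `EmbeddedDrudeMourre.AbelThermodynamicLimit` (stmt-AtomisticToContinuum-12596). [folklore] -/
theorem twinCrux_of_uniformSignedTail_of_lowerBound :
    (∀ ω₂ lam β γ : ℝ, 0 < ω₂ → 0 < lam → 0 < β → 0 < γ → ∀ T : ℝ, 0 < T → ∀ ε : ℝ, 0 < ε → ∃ τ : ℝ, 0 < τ ∧ ∃ N₀ : ℕ, ∀ N : ℕ, N₀ ≤ N → ∀ t : ℝ, τ ≤ t → let J : Literature.MathematicalPhysics.KineticTheory.HeatConduction.PhaseSpace N → ℝ := fun z => ∑ i : Fin N, (Literature.MathematicalPhysics.KineticTheory.HeatConduction.pinnedChain ω₂ lam β γ).bondCurrent N i z; |∫ s in Set.Ioi t, ∫ z, J z * (∫ y, J y ∂((Literature.MathematicalPhysics.KineticTheory.HeatConduction.pinnedChain ω₂ lam β γ).transitionKernel N T T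 s.toNNReal z)) ∂((Literature.MathematicalPhysics.KineticTheory.HeatConduction.pinnedChain ω₂ lam β γ).gibbsMeasure N T)| ≤ ε * N) → Summit.AtomisticToContinuum.FouriersLaw.Theses.StaticAbelianSqueeze.ConductanceLowerBound → Summit.AtomisticToContinuum.FouriersLaw.Theses.EmbeddedDrudeMourre.AbelThermodynamicLimit :=
  fun h hCLB =>
    Summit.AtomisticToContinuum.FouriersLaw.Theorems.AbelThermodynamicLimit.LoomisCompactHorizonWitness.stub_cruxOfRegularityOfLowerBound
      (stub_uniformAbelianRegularityOfUniformSignedTail h) hCLB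

end Summit.AtomisticToContinuum.FouriersLaw.Theorems.AbelThermodynamicLimit.SeriesLawAtEveryLaplaceFrequency

end
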